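import Mathlib.Analysis.InnerProductSpace.Basic
import HarnessLib

/-!
# Route `UnitScaleTilt`, crux K1 «MinimiserStabilityRegPr» (stmt-QuantumFields-19200), EX row `hGF[Lift]` (curved member) — **LOD LINE, PEN (L5″) (RN-near) OPERATOR KNIT:
# THE GRAM DIFFERENCE ON A COARSE VECTOR SUPPORTED NEAR THE CUBE** — the `hnear` row of routeR-w3 g12's 2r-door ✓`Prop7GramDifferenceNearFarSplit.sqrt_normSq_mulVec_le_near_far`
at OPERATOR level: with `M_W = S_W G_W G_W T_W`, `M_1 = S_1 G_1 G_1 T_1` (`B = G∘T`, `B† = S∘G`, `M = B†B`), for a coarse vector `c` whose `T_1 c` is fixed by the plateau cut-off,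
`‖M_1 c − M_W c‖ ≤ ε_N‖c‖`, `ε_N` an explicit polynomial in the landed px5 rows: the `S`-row with tail (✓`Prop7TopMeanComparisonOnPropagator`, p755451), the `G`-row on cut-off-fixed
vectors (✓`Prop7PropagatorComparisonOnCutoff`, p755265), the `T`-row (✓`Prop7TopMeanAdjointTwoBackgrounds`, p755981), the tails of propagated vectors off the fattened cut-off
(✓`Prop7MassivePropagatorTail`, p756369) and the global norms `‖S‖, ‖T‖ ≤ C`, `‖G‖ ≤ ν`.  ABSTRACT inner-product-space algebra (any `E`, `C`; the cut-offs are linear maps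
`Xp` (plateau) and `Xt` (fattened, `Xp ∘ Xt = Xt`, `‖Xt v‖ ≤ ‖v‖`)).

THE SPLIT.  `M_1c − M_Wc = (S_1 − S_W)u + S_W[(G_1 − G_W)v + G_W((G_1 − G_W)w) + G_W(G_W(T_1c − T_Wc))]`, `w = T_1c`, `v = G_1w`, `u = G_1v`; `w` is plateau-fixed (`Xp w = w`, the
`G`-row applies as is), `v` and `u` are propagated (the `G`-row∕`S`-row apply to `Xt v`∕`u` with the tails `‖v − Xt v‖`, `‖u − Xt u‖` as separate numbers).

Cell `ym3-torus` (HUMAN RULING D-0037, YM ladder rung R3 — NOT d = 4, NOT infinite volume, NOT a mass gap, NOT Clay).  Width seat `ym3-torus-px5` gen 11; ★p1 g24 LOCATE-L6-ASSEMBLY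
§1 Step I.2 (L5″), road (α); routeR-w3 g12 2026-08-30 01:54:13Z 2r-door («(RN-near) = px5's (RB)-apparatus»).  THEOREMS ONLY (0 `def`, 0 `sorry`), Mathlib-only + HarnessLib;
`--supports stmt-QuantumFields-19200 --as helper`, count-neutral.  HONEST LABEL (★★OWNER RULING №33 (6)): curved γ-row supplier line (LOD localisation), pen (L5″); pure
bookkeeping — every analytic input is a displayed row; nothing of (3.49), Thm 3.1∕3.3, `h349`, `hGF`, EX ∕ 19200 is proved here.

References: T. Bałaban, CMP **99** (1985) 389–434 [Balaban1985BackgroundPropagators] ((3.21)–(3.23) p.394, (3.49) p.399, Thm 3.3 p.399, (3.105) p.414).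
-/

set_option autoImplicit false

noncomputable section

open scoped InnerProductSpace ComplexConjugate

namespace Summit.QuantumFields.YangMills.Theorems.Prop7GramDifferenceNearRow

variable {E C : Type*} [NormedAddCommGroup E] [InnerProductSpace ℂ E] [NormedAddCommGroup C] [InnerProductSpace ℂ C]

/-! ## §1 The `G`-row with a tail -/

/-- ★ **THE PROPAGATOR ROW ON AN ARBITRARY VECTOR, FROM THE CUT-OFF-FIXED ROW PLUS A TAIL**: if `‖G_1 h − G_W h‖ ≤ c_G‖h‖` whenever `Xp h = h` (✓p755265), the fattened cut-off
`Xt` lands in the plateau (`Xp(Xt v) = Xt v`) and contracts (`‖Xt v‖ ≤ ‖v‖`), and `‖G_1‖, ‖G_W‖ ≤ ν`, then for EVERY `v`: `‖G_1 v − G_W v‖ ≤ c_G‖v‖ + 2ν‖v − Xt v‖`.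
[cite: Balaban1985BackgroundPropagators, Thm 3.3 p.399, (3.105) p.414] -/
theorem norm_inv_sub_inv_le_of_tail (G1 GW Xp Xt : E →ₗ[ℂ] E) {cG ν : ℝ} (hcG : 0 ≤ cG)
    (hRB1 : ∀ h : E, Xp h = h → ‖G1 h - GW h‖ ≤ cG * ‖h‖) (hXpXt : ∀ v, Xp (Xt v) = Xt v) (hXt : ∀ v, ‖Xt v‖ ≤ ‖v‖)
    (hG1 : ∀ v, ‖G1 v‖ ≤ ν * ‖v‖) (hGW : ∀ v, ‖GW v‖ ≤ ν * ‖v‖) (v : E) :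
    ‖G1 v - GW v‖ ≤ cG * ‖v‖ + 2 * ν * ‖v - Xt v‖ := by
  have e : G1 v - GW v = (G1 (Xt v) - GW (Xt v)) + (G1 (v - Xt v) - GW (v - Xt v)) := by
    rw [map_sub, map_sub]; abel
  rw [e]
  calc ‖(G1 (Xt v) - GW (Xt v)) + (G1 (v - Xt v) - GW (v - Xt v))‖
      ≤ ‖G1 (Xt v) - GW (Xt v)‖ + (‖G1 (v - Xt v)‖ + ‖GW (v - Xt v)‖) := (norm_add_le _ _).trans (add_le_add le_rfl (norm_sub_le _ _))
    _ ≤ cG * ‖Xt v‖ + (ν * ‖v - Xt v‖ + ν * ‖v - Xt v‖) := add_le_add (hRB1 _ (hXpXt v)) (add_le_add (hG1 _) (hGW _))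
    _ ≤ cG * ‖v‖ + (ν * ‖v - Xt v‖ + ν * ‖v - Xt v‖) := by gcongr; exact hXt v
    _ = cG * ‖v‖ + 2 * ν * ‖v - Xt v‖ := by ring

/-! ## §2 The split and the knit -/

/-- ★★ **THE GRAM-DIFFERENCE SPLIT** (pure algebra): with `w = T_1 c`, `v = G_1 w`, `u = G_1 v`,
`S_1(G_1(G_1(T_1 c))) − S_W(G_W(G_W(T_W c))) = (S_1 u − S_W u) + S_W((G_1 v − G_W v) + G_W(G_1 w − G_W w) + G_W(G_W(T_1 c − T_W c)))`.
[cite: Balaban1985BackgroundPropagators, (3.21)-(3.23) p.394] -/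
theorem gram_apply_sub_gram_apply_eq (S1 SW : E →ₗ[ℂ] C) (T1 TW : C →ₗ[ℂ] E) (G1 GW : E →ₗ[ℂ] E) (c : C) :
    S1 (G1 (G1 (T1 c))) - SW (GW (GW (TW c)))
      = (S1 (G1 (G1 (T1 c))) - SW (G1 (G1 (T1 c))))
        + SW ((G1 (G1 (T1 c)) - GW (G1 (T1 c))) + GW (G1 (T1 c) - GW (T1 c)) + GW (GW (T1 c - TW c))) := by
  simp only [map_sub, map_add]; abel

/-- ★★★ **THE (RN-near) ROW AT OPERATOR LEVEL**: global norms `‖S_W l‖ ≤ C_S‖l‖`, `‖T_1 c‖ ≤ C_T‖c‖`, `‖G_1‖, ‖G_W‖ ≤ ν`; the `T`-row `‖T_1 c − T_W c‖ ≤ δ_T‖c‖` (✓p755981); the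
`S`-row with tail `‖S_1 u − S_W u‖ ≤ δ_S‖u‖ + s‖u − Xt u‖` (✓p755451); the cut-off-fixed `G`-row `Xp h = h ⟹ ‖G_1 h − G_W h‖ ≤ c_G‖h‖` (✓p755265) with `Xp(Xt ·) = Xt`, `‖Xt ·‖ ≤ ‖·‖`;
the plateau fixing `Xp(T_1 c) = T_1 c` of THIS `c` (its `d` supported in `N`); and the two tail numbers `‖v − Xt v‖ ≤ τ_v‖c‖`, `‖u − Xt u‖ ≤ τ_u‖c‖` of the propagated vectors
`v = G_1(T_1 c)`, `u = G_1 v` (✓p756369-class) give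
**`‖M_1 c − M_W c‖ ≤ (δ_S·ν²C_T + s·τ_u + C_S·(c_G·νC_T + 2ν·τ_v + ν·c_G·C_T + ν²·δ_T))·‖c‖`** — 2r-door's `hnear` with this `ε_N`.
[cite: Balaban1985BackgroundPropagators, (3.21)-(3.23) p.394, (3.49) p.399, Thm 3.3 p.399] -/
theorem norm_gram_apply_sub_le_near (S1 SW : E →ₗ[ℂ] C) (T1 TW : C →ₗ[ℂ] E) (G1 GW Xp Xt : E →ₗ[ℂ] E)
    {CS CT ν δT δS s cG τv τu : ℝ} (hCS : 0 ≤ CS) (hν : 0 ≤ ν) (hδS : 0 ≤ δS) (hs : 0 ≤ s) (hcG : 0 ≤ cG)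
    (hSW : ∀ l, ‖SW l‖ ≤ CS * ‖l‖) (hG1 : ∀ v, ‖G1 v‖ ≤ ν * ‖v‖) (hGW : ∀ v, ‖GW v‖ ≤ ν * ‖v‖)
    (hS : ∀ u, ‖S1 u - SW u‖ ≤ δS * ‖u‖ + s * ‖u - Xt u‖)
    (hRB1 : ∀ h : E, Xp h = h → ‖G1 h - GW h‖ ≤ cG * ‖h‖) (hXpXt : ∀ v, Xp (Xt v) = Xt v) (hXt : ∀ v, ‖Xt v‖ ≤ ‖v‖)
    (c : C) (hT1c : ‖T1 c‖ ≤ CT * ‖c‖) (hT : ‖T1 c - TW c‖ ≤ δT * ‖c‖) (hXpT : Xp (T1 c) = T1 c)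
    (hτv : ‖G1 (T1 c) - Xt (G1 (T1 c))‖ ≤ τv * ‖c‖) (hτu : ‖G1 (G1 (T1 c)) - Xt (G1 (G1 (T1 c)))‖ ≤ τu * ‖c‖) :
    ‖S1 (G1 (G1 (T1 c))) - SW (GW (GW (TW c)))‖
      ≤ (δS * (ν ^ 2 * CT) + s * τu + CS * (cG * (ν * CT) + 2 * ν * τv + ν * (cG * CT) + ν ^ 2 * δT)) * ‖c‖ := by
  set w : E := T1 c with hw
  set v : E := G1 w with hv
  set u : E := G1 v with hu
  have hc0 : 0 ≤ ‖c‖ := norm_nonneg _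
  have hwn : ‖w‖ ≤ CT * ‖c‖ := hT1c
  have hCT0 : 0 ≤ CT * ‖c‖ := (norm_nonneg _).trans hwn
  have hvn : ‖v‖ ≤ ν * (CT * ‖c‖) := (hG1 w).trans (mul_le_mul_of_nonneg_left hwn hν)
  have hun : ‖u‖ ≤ ν * (ν * (CT * ‖c‖)) := (hG1 v).trans (mul_le_mul_of_nonneg_left hvn hν)
  -- the four pieces
  have hA : ‖S1 u - SW u‖ ≤ δS * (ν * (ν * (CT * ‖c‖))) + s * (τu * ‖c‖) :=
    (hS u).trans (add_le_add (mul_le_mul_of_nonneg_left hun hδS) (mul_le_mul_of_nonneg_left hτu hs))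
  have hB : ‖G1 v - GW v‖ ≤ cG * (ν * (CT * ‖c‖)) + 2 * ν * (τv * ‖c‖) :=
    (norm_inv_sub_inv_le_of_tail G1 GW Xp Xt hcG hRB1 hXpXt hXt hG1 hGW v).trans
      (add_le_add (mul_le_mul_of_nonneg_left hvn hcG) (mul_le_mul_of_nonneg_left hτv (by positivity)))
  have hCpiece : ‖GW (G1 w - GW w)‖ ≤ ν * (cG * (CT * ‖c‖)) :=
    (hGW _).trans (mul_le_mul_of_nonneg_left ((hRB1 w hXpT).trans (mul_le_mul_of_nonneg_left hwn hcG)) hν)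
  have hD : ‖GW (GW (T1 c - TW c))‖ ≤ ν * (ν * (δT * ‖c‖)) :=
    (hGW _).trans (mul_le_mul_of_nonneg_left ((hGW _).trans (mul_le_mul_of_nonneg_left hT hν)) hν)
  have hin : ‖(G1 v - GW v) + GW (G1 w - GW w) + GW (GW (T1 c - TW c))‖
      ≤ (cG * (ν * (CT * ‖c‖)) + 2 * ν * (τv * ‖c‖)) + ν * (cG * (CT * ‖c‖)) + ν * (ν * (δT * ‖c‖)) :=
    (norm_add₃_le).trans (add_le_add (add_le_add hB hCpiece) hD)
  rw [gram_apply_sub_gram_apply_eq S1 SW T1 TW G1 GW c]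
  calc _ ≤ ‖S1 u - SW u‖ + ‖SW ((G1 v - GW v) + GW (G1 w - GW w) + GW (GW (T1 c - TW c)))‖ := norm_add_le _ _
    _ ≤ (δS * (ν * (ν * (CT * ‖c‖))) + s * (τu * ‖c‖))
        + CS * ((cG * (ν * (CT * ‖c‖)) + 2 * ν * (τv * ‖c‖)) + ν * (cG * (CT * ‖c‖)) + ν * (ν * (δT * ‖c‖))) :=
        add_le_add hA ((hSW _).trans (mul_le_mul_of_nonneg_left hin hCS))
    _ = _ := by ring

end Summit.QuantumFields.YangMills.Theorems.Prop7GramDifferenceNearRow
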